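import Summits.QuantumFields.YangMills.Theorems.BalabanUVNodesN08StubNodes12Currency
import Summits.QuantumFields.YangMills.Theorems.BalabanUVNodesN08UniformO1
import Literature.MathematicalPhysics.QuantumFieldTheory.Balaban1983to89.Node00.Record12LiveSelector
import Literature.MathematicalPhysics.QuantumFieldTheory.Balaban1983to89.Node00.Record12LiveSelectorTorus

/-!
# Route «BalabanUVNodes», Track-A DAG node N08 = [Balaban1985UV3] Thm 1 p. 257 (compact reading) ∧ Thm 2 p. 272 —
# N08's SHARE OF `stub_nodes12` IS SELECTOR-BLIND; THE K0′ WITNESS LINES OF RECORD `θ₀` AND `θ₀ˡⁱᵛᵉ` (director LINE №114 (α)) IN THE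
# THREE TYPED SUPPLIER CURRENCIES OF THE [B10] SLOT, and N08's CONJUNCT OF `NodesAtSomeRecord12` WITNESSED AT `θ₀ˡⁱᵛᵉ`
# (crux `StabilityBAtRecordR12e` = stmt-QuantumFields-19903, route rev 15)

Cell `pub-ymgap`, seat `pub-ymgap-dag-n08-c` gen 4 (director-ym R134 row N08 s2 «by-name knit at the record of record»; successor service of this seat's
`BalabanUVNodesN08StubNodes12Currency` p474298).  Filed `--supports stmt-QuantumFields-19903 --as helper`.  THEOREMS ONLY (0 `def`, 0 `instance`).

WHY THIS FILE.  Director-ym LINE №114 (α) re-pins the K0′ witness of record by CHANGING ITS SELECTOR ONLY — node00-def-K0a's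
`Node00/Record12LiveSelector.lean` (p477230): `Stage12Params.liveRepin θ := { θ with ppSel := ppSelLiveOfRecord … }` and
`theta12LiveOfRecord F N ζ Rz Zt := (theta12OfRecord F N ζ Rz Zt).liveRepin F N` (dag-lead TABLE v30 § K0′ components «witness candidate θ₀ˡⁱᵛᵉ») —, and LINE №118
guards the selector-reading conjunct `Stage12Params.SlotsNondegenerate` by the level (def-T `Record12` v2.3).  The `p–p′` selector `θ.ppSel` (a RESIDUAL field of
`Stage9Params`, [IV] (0.3) «NO CANONICAL CHOICE on sequences») is read by the slot families of the density tower (`Provisos₁₂.base`, the datum) and by the guard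
`SlotsNondegenerate` — and by NOTHING N08's conjunct of `stub_nodes12` consumes: the block size `θ.L`, the window `θ.γ`, the Stage-3 carrier part `θ.toStage3Params`
(where the operator ∕ [B8] ∕ [B13] layers live), `Admissible` and `ZtUnity` are literally the same terms at `θ` and at ANY re-selection `{θ with ppSel := sel}` (kernel
`rfl` ∕ `Iff.rfl`, §A; K0a's `liveRepin_*` views are the instance at the live selector).  Hence N08's pointed closers and ∃-currency worlds of p474298 apply VERBATIM at
every re-selected tuple with the cost still the one slot instance `Node00.PrintedUV3V N θ.L` (§A), and on the RE-PINNED WITNESS LINE OF RECORD `θ₀ˡⁱᵛᵉ` N08's share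
costs K0′'s own provisos there and THE SINGLE PROP `Node00.PrintedUV3V N 3` (§C; `N = 2`: [Balaban1985UV3] Thm 1-compact ∧ Thm 2 with their printed ∃-prefix for SU(2),
block size 3) — so N08's conjunct of `NodesAtSomeRecord12` is witnessed AT `θ₀ˡⁱᵛᵉ` from K0′'s two open rows there and that prop (§D).  §B and §C also display the cost
in the THREE TYPED SUPPLIER CURRENCIES of the slot, AT BLOCK SIZE 3 ONLY (the line of record reads no other `L`):
(u) UNIFORM LEAF SYSTEMS on print's `L = 3` runs at some version `𝔗 : TFamily₃ N 3` of print's transformations (n08-a `printedUV3V_of_uniformLeafSystems_at`);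
(r) «RELATIVE TO (5)»: Thm 1's bounds (5) in the compact reading as located hypothesis + per-run representation data (n08-e `printedUV3V_of_thm1Compact_perRun`);
(o) per-run data with a RUN-UNIFORM O(1) (n08-a `printedUV3V_of_perRunUniformO1`).
WHAT THIS FILE DOES.
* §A RE-SELECTION BLINDNESS (generic `θ`, generic `sel`): `reselect_L ∕ _γ ∕ _toStage3Params` (`rfl`), `reselect_admissible_iff ∕ reselect_ztUnity_iff` (`Iff.rfl`);
  the pointed closer at the C-binding over the four-pin view of a re-selected tuple with the operator layer typed AT `θ` (`b10_main_of_upC_view₁₂B10YZW_reselect`);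
  the ∃-currency worlds at the datum of a re-selected tuple from admissibility OF `θ` and `PrintedUV3V N θ.L` (`exists_world₁₂C_b10_main_of_slot_reselect`, [B8]-keyed
  twin).  NOT claimed (false in general, the point of №114): invariance of `SlotsNondegenerate`, of `Provisos₁₂`, or of the datum under re-selection.
* §B THE θ₀ LINE (`theta12OfRecord`, `L = 3`, `γ = 1∕2`): the [B8]-keyed five-pin world at θ₀'s datum (p474298 §3 had the C-binding only), and the C-binding world in
  the currencies (u) (r) (o).
* §C THE RE-PINNED LINE `θ₀ˡⁱᵛᵉ` BY NAME: `theta12LiveOfRecord_L = 3`, `theta12LiveOfRecord_toStage3Params = θ₀.toStage3Params` (`rfl` — a layer typed at `θ₀` serves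
  `θ₀ˡⁱᵛᵉ`), the C-binding and [B8]-keyed worlds of `datumOfRecord₁₂ F N θ₀ˡⁱᵛᵉ hP` from `PrintedUV3V N 3` (admissibility = K0a's `admissible_theta12LiveOfRecord`; §A at the
  live selector by `exact`), the exact cost reading, and the currencies (u) (r) (o).
* §D AT K0b's RESIDUALS OF RECORD (`zeta316OfRecord`, `RzOfRecord`, `ZtOfRecord`; K0a's `ztUnity_theta12LiveOfRecord`): K0′'s provisos `hP` + its conjunct
  `θ₀ˡⁱᵛᵉ.SlotsNondegenerate` (HYPOTHESES, opaque — indifferent to the v2.3 guard) + `PrintedUV3V N 3` ⇒ N08's conjunct of plan g64's `NodesAtSomeRecord12` witnessed AT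
  `θ₀ˡⁱᵛᵉ` (`exists_guarded_record₁₂C_b10_main_at_theta12LiveOfRecord`; `N = 2` in the stub's own ∃-binder text: `exists_guarded_record₁₂C_b10_main_of_theta12Live_two`).
* §D′ (v1.1, after node00-def-K0a's `Node00/Record12LiveSelectorTorus` v1.1): the SAME with `hS` DISCHARGED — K0a's `slotsNondegenerate_theta12LiveOfRecord` from the
  `base` field (`Provisos₁₀`) of `hP` under def-T's `Record12` v2.3 guard — so on the witness line of record N08's conjunct of `NodesAtSomeRecord12` costs K0′'s `Provisos₁₂`
  at `θ₀ˡⁱᵛᵉ` and `PrintedUV3V N 3`, NOTHING ELSE (`exists_guarded_record₁₂C_b10_main_at_theta12LiveOfRecord_of_provisos`, `…_of_theta12Live_provisos_two`).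
HONEST FRAMING: count-neutral kernel bookkeeping BY NAME over landed modules (p474298, p466715, n08-a `…N08AtRecord9CB10` ∕ `…N08UniformO1`, n08-e `…N08RelativeTo5`,
node00-def-K0a `Node00.Record12Numerics` ∕ `Node00.Record12LiveSelector`, K0b `Node00.Record12Residuals`, node00-def g32 ∕ g33 `Node00.Record12Carriers(Records)`); nothing of
Bałaban's asserted; `PrintedUV3V` and each supplier currency's data are TYPED, NOT PROVED — an inhabitant (the [B10] cluster expansion at print's run objects) remains THE
object gap of N08; N08 NOT discharged; K0′ ∕ K1′ neither proved nor assumed beyond the displayed hypotheses (`hP`, `hS` = K0′'s open rows at the line, never constructed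
here); one finite four-torus per run at fixed `ε`, [B10]'s d = 3 lattices inside the record; nothing continuum ∕ ℝ⁴ ∕ OS ∕ mass gap ∕ Clay.  0 `sorry`, 0 `def`, standard axioms.
Sources: [Balaban1985UV3] Thm 1 p.257, Thm 2 p.272, Sect. D pp.272–275; [Balaban1989LargeFieldII] Thm 1 + (0.1) pp.355–356; [Balaban1989LargeFieldI] (0.3) p.176;
[Balaban1988Convergent] Thm 1 p.262, (3.16)–(3.22) pp.268–269; [Balaban1987RG1] (0.21) p.256.
-/

noncomputable section

namespace Summit.QuantumFields.YangMills.BalabanUVNodes.N08StubNodes12WitnessLines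

open Literature.MathematicalPhysics.QuantumFieldTheory.Balaban1983to89
open Literature.MathematicalPhysics.QuantumFieldTheory.Balaban1983to89.T4Continuum (T4Family FiniteEpsData)
open Literature.MathematicalPhysics.QuantumFieldTheory.Balaban1983to89.DagBinding (WorldP leavesP)
open Literature.MathematicalPhysics.QuantumFieldTheory.Balaban1983to89.Node00
open Literature.MathematicalPhysics.QuantumFieldTheory.Balaban1983to89.B10RunsOfRecord (Consts UniformLeafSystemsG runObjects₀T Backgrounds runsAtG)
open Literature.MathematicalPhysics.QuantumFieldTheory.Balaban1985CMP102
open Literature.MathematicalPhysics.QuantumFieldTheory.Balaban1985CMP102.Setting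
open Literature.MathematicalPhysics.QuantumFieldTheory.Balaban1985CMP102.Theorems (Family)
open Summit.QuantumFields.YangMills.BalabanUVNodes.N08StubNodes12Currency
open Summit.QuantumFields.YangMills.BalabanUVNodes.N06AtRecord9CB10Y (exists_junkOps_b9LeafX_Y9OfRecord)
open Summit.QuantumFields.YangMills.BalabanUVNodes.N08AtRecord9CB10 (printedUV3V_of_uniformLeafSystems_at)
open Summit.QuantumFields.YangMills.Theorems.BalabanUVNodesN08RelativeTo5 (printedUV3V_of_thm1Compact_perRun)
open Summit.QuantumFields.YangMills.Theorems.BalabanUVNodesN08UniformO1 (printedUV3V_of_perRunUniformO1)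
open scoped Matrix.Norms.L2Operator

variable {F : T4Family} {N : ℕ} [NeZero N]

/-! ## §A RE-SELECTION BLINDNESS OF N08's SHARE — generic tuple `θ`, generic `p–p′` selector `sel` -/

section Reselect
variable (θ : Stage12Params F N) (sel : PpSelOfRecord F θ.ν θ.τ9.M)

/-- Re-selecting the `p–p′` selector keeps Bałaban's block size `L` (`rfl`). [cite: Balaban1989LargeFieldI, (0.3) p.176 (the selection `Z ↦ Z″`); Balaban1987RG1, (0.21) p.256 (bookkeeping)] -/
theorem reselect_L : ({ θ with ppSel := sel } : Stage12Params F N).L = θ.L := rfl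

/-- … keeps the coupling-window height `γ` (`rfl`). [cite: Balaban1988Convergent, (2.10) p.256 (bookkeeping)] -/
theorem reselect_γ : ({ θ with ppSel := sel } : Stage12Params F N).γ = θ.γ := rfl

/-- … keeps the Stage-3 carrier part, where the operator ∕ [B8] ∕ [B13] residual layers are typed (`rfl`). [cite: Balaban1989LargeFieldII, Thm 1 + (0.1) pp.355–356 (objects of record; bookkeeping)] -/
theorem reselect_toStage3Params : ({ θ with ppSel := sel } : Stage12Params F N).toStage3Params = θ.toStage3Params := rfl

/-- … keeps Stage-12 ADMISSIBILITY (`Iff.rfl`: Stage-9 admissibility · `s2.Pos` · `Pos₁₂` read no selector). [cite: Balaban1987RG1, (1.12) p.262; Balaban1988Convergent, (2.10) p.256, (2.34)–(2.39) p.261, (3.4) p.265 (hypothesis dictionary; bookkeeping)] -/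
theorem reselect_admissible_iff : ({ θ with ppSel := sel } : Stage12Params F N).Admissible F N ↔ θ.Admissible F N := Iff.rfl

/-- … keeps PRINT'S PARTITION OF UNITY `ZtUnity` (`Iff.rfl`: it reads `Zt`, the numerics and the generated history, no selector).  NOT claimed — and false in general,
the point of director LINE №114 (α) — : invariance of the OTHER guard conjunct `SlotsNondegenerate`, which reads the slot families through `ppSel`.
[cite: Balaban1988Convergent, (3.16)–(3.20) pp.268–269 (bookkeeping)] -/
theorem reselect_ztUnity_iff : ({ θ with ppSel := sel } : Stage12Params F N).ZtUnity F N ↔ θ.ZtUnity F N := Iff.rfl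

/-- **N08 AT THE C-BINDING OVER THE FOUR-PIN VIEW OF A RE-SELECTED TUPLE**, operator layer typed AT `θ`, cost `PrintedUV3V N θ.L` — p474298's pointed closer verbatim
(the view's block size is `θ.L` by `rfl`). [cite: Balaban1985UV3, Thm 1 p.257, Thm 2 p.272; Balaban1989LargeFieldII, Thm 1 + (0.1) pp.355–356 (bookkeeping)] -/
theorem b10_main_of_upC_view₁₂B10YZW_reselect {w : WorldP} (Mstar : ℕ) (ops : OpsY N θ.toStage3Params Mstar) (ζ : ResidZ F N) (lamW : ResidW F N)
    (hup : ∀ P, w.up P = upOfRecord₅C F N (({ θ with ppSel := sel } : Stage12Params F N).view₁₂B10YZW F N Mstar ops ζ lamW) P)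
    (hUV : PrintedUV3V N θ.L) (P : B12.RunParams) : Dag.B10_main (leavesP w P) :=
  b10_main_of_upC_view₁₂B10YZW ({ θ with ppSel := sel } : Stage12Params F N) Mstar ops ζ lamW hup hUV P

/-- **THE ∃-CURRENCY WORLD AT THE DATUM OF A RE-SELECTED TUPLE** (provisos `h` AT the re-selected tuple — they read the selector —; admissibility OF `θ`; package exposed;
any window height `γw ≤ θ.γ`): a four-pin world that is a `₁₂C` and a `₁₂CB10YZW` record of that datum with block size `θ.L`, carrying N08 at every run, from
`PrintedUV3V N θ.L`. [cite: Balaban1985UV3, Thm 1 p.257, Thm 2 p.272; Balaban1989LargeFieldII, Thm 1 + (0.1) pp.355–356 (the record's world; bookkeeping)] -/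
theorem exists_world₁₂C_b10_main_of_slot_reselect (h : ({ θ with ppSel := sel } : Stage12Params F N).Provisos₁₂ F N) (hθ : θ.Admissible F N)
    (Mstar : ℕ) (ops : OpsY N θ.toStage3Params Mstar) (ζ : ResidZ F N) (lamW : ResidW F N) {γw : ℝ} (hγw : 0 < γw ∧ γw ≤ θ.γ)
    (hUV : PrintedUV3V N θ.L) :
    ∃ w : WorldP, IsRecordOfRecord₁₂C F N (datumOfRecord₁₂ F N ({ θ with ppSel := sel } : Stage12Params F N) h) w ∧
      IsRecordOfRecord₁₂CB10YZW F N (datumOfRecord₁₂ F N ({ θ with ppSel := sel } : Stage12Params F N) h) w ∧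
      w.γ = γw ∧ w.L = (θ.L : ℝ) ∧
      (∀ P, w.up P = upOfRecord₅C F N (({ θ with ppSel := sel } : Stage12Params F N).view₁₂B10YZW F N Mstar ops ζ lamW) P) ∧
      ∀ P : B12.RunParams, Dag.B10_main (leavesP w P) :=
  exists_world₁₂C_b10_main_of_slot ({ θ with ppSel := sel } : Stage12Params F N) h ((reselect_admissible_iff θ sel).2 hθ) Mstar ops ζ lamW hγw hUV

/-- **The [B8]-keyed twin** at the datum of a re-selected tuple ([B8] layer `lam` typed AT `θ`). [cite: Balaban1985UV3, Thm 1 p.257, Thm 2 p.272; Balaban1985RegularSpaces, Thm 8 p.101; Balaban1989LargeFieldII, Thm 1 + (0.1) pp.355–356 (bookkeeping)] -/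
theorem exists_world₁₂CB10YZWB8_b10_main_of_slot_reselect (h : ({ θ with ppSel := sel } : Stage12Params F N).Provisos₁₂ F N)
    (hθ : θ.Admissible F N) (lam : ResidB8 θ.toStage3Params) (Mstar : ℕ) (ops : OpsY N θ.toStage3Params Mstar) (ζ : ResidZ F N) (lamW : ResidW F N)
    {γw : ℝ} (hγw : 0 < γw ∧ γw ≤ θ.γ) (hUV : PrintedUV3V N θ.L) :
    ∃ w : WorldP, IsRecordOfRecord₁₂CB10YZWB8 F N (datumOfRecord₁₂ F N ({ θ with ppSel := sel } : Stage12Params F N) h) w ∧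
      w.γ = γw ∧ w.L = (θ.L : ℝ) ∧
      (∀ P, w.up P = upOfRecord₅CS F N (({ θ with ppSel := sel } : Stage12Params F N).view₁₂B8B10YZW F N lam Mstar ops ζ lamW) P) ∧
      ∀ P : B12.RunParams, Dag.B10_main (leavesP w P) :=
  exists_world₁₂CB10YZWB8_b10_main_of_slot ({ θ with ppSel := sel } : Stage12Params F N) h ((reselect_admissible_iff θ sel).2 hθ) lam Mstar ops ζ
    lamW hγw hUV

end Reselect

/-! ## §B THE θ₀ LINE `theta12OfRecord F N ζ Rz Zt` (`L = 3`, `γ = 1∕2`): the [B8]-keyed world, and the three supplier currencies at block size 3 -/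

section WitnessLine
variable (ζ : ZetaOfRecord F N numerics7OfRecord₁₂ 1) (Rz : (K : ℕ) → Sect2.Residual (F.P K) (MatA N)) (Zt : (K : ℕ) → TkResidualW F N (FluctV N) K)

/-- **THE [B8]-KEYED FIVE-PIN WORLD ON THE θ₀ LINE** ([B8] layer `lam`, package exposed, `w.γ = 1∕2`, `w.L = 3`): a `₁₂CB10YZWB8` record of `datumOfRecord₁₂ F N θ₀ hP` carrying N08 at
every run, from K0′'s provisos `hP` at θ₀ (HYPOTHESIS) and `PrintedUV3V N 3`; admissibility is node00-def-K0a's theorem. [cite: Balaban1985UV3, Thm 1 p.257, Thm 2 p.272; Balaban1985RegularSpaces, Thm 8 p.101; Balaban1987RG1, (0.21) p.256 (bookkeeping)] -/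
theorem exists_world₁₂CB10YZWB8_b10_main_at_theta12OfRecord (hP : (theta12OfRecord F N ζ Rz Zt).Provisos₁₂ F N)
    (lam : ResidB8 (theta12OfRecord F N ζ Rz Zt).toStage3Params) (Mstar : ℕ) (ops : OpsY N (theta12OfRecord F N ζ Rz Zt).toStage3Params Mstar)
    (ζ' : ResidZ F N) (lamW : ResidW F N) (hUV : PrintedUV3V N 3) :
    ∃ w : WorldP, IsRecordOfRecord₁₂CB10YZWB8 F N (datumOfRecord₁₂ F N (theta12OfRecord F N ζ Rz Zt) hP) w ∧ w.γ = 1 / 2 ∧ w.L = 3 ∧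
      (∀ P, w.up P = upOfRecord₅CS F N ((theta12OfRecord F N ζ Rz Zt).view₁₂B8B10YZW F N lam Mstar ops ζ' lamW) P) ∧
      ∀ P : B12.RunParams, Dag.B10_main (leavesP w P) := by
  obtain ⟨w, hR, hγ, hL, hup, hN⟩ := exists_world₁₂CB10YZWB8_b10_main_of_slot (theta12OfRecord F N ζ Rz Zt) hP
    (admissible_theta12OfRecord F N ζ Rz Zt) lam Mstar ops ζ' lamW (γw := 1 / 2) ⟨one_half_pos, (theta12OfRecord_γ F N ζ Rz Zt).symm.le⟩ hUV
  exact ⟨w, hR, hγ, by rw [hL, theta12OfRecord_L]; norm_num, hup, hN⟩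

/-- **CURRENCY (u) ON THE θ₀ LINE — UNIFORM LEAF SYSTEMS AT BLOCK SIZE 3**: a version `𝔗` of print's transformations on the `L = 3` runs, admissible constants `c` and
uniform leaf systems on print's run objects `runObjects₀T N 𝔗 (Backgrounds.ofPrint N 3)` give N08's four-pin world at θ₀'s datum (n08-a's supplier face into p474298 §3).
[cite: Balaban1985UV3, Thm 1 p.257, Thm 2 p.272, Sect. D pp.272–275; Balaban1985Averaging, (10) p.19] -/
theorem exists_world₁₂C_b10_main_at_theta12OfRecord_of_uniformLeafSystemsG (hP : (theta12OfRecord F N ζ Rz Zt).Provisos₁₂ F N) (Mstar : ℕ)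
    (ops : OpsY N (theta12OfRecord F N ζ Rz Zt).toStage3Params Mstar) (ζ' : ResidZ F N) (lamW : ResidW F N)
    (𝔗 : TFamily₃ N 3) (c : Consts 3) (hc : c.Adm) (hU : UniformLeafSystemsG N (runObjects₀T N 𝔗 (Backgrounds.ofPrint N 3)) c) :
    ∃ w : WorldP, IsRecordOfRecord₁₂C F N (datumOfRecord₁₂ F N (theta12OfRecord F N ζ Rz Zt) hP) w ∧
      IsRecordOfRecord₁₂CB10YZW F N (datumOfRecord₁₂ F N (theta12OfRecord F N ζ Rz Zt) hP) w ∧ w.γ = 1 / 2 ∧ w.L = 3 ∧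
      (∀ P, w.up P = upOfRecord₅C F N ((theta12OfRecord F N ζ Rz Zt).view₁₂B10YZW F N Mstar ops ζ' lamW) P) ∧
      ∀ P : B12.RunParams, Dag.B10_main (leavesP w P) :=
  exists_world₁₂C_b10_main_at_theta12OfRecord ζ Rz Zt hP Mstar ops ζ' lamW (printedUV3V_of_uniformLeafSystems_at 𝔗 ⟨c, hc, hU⟩)

/-- **CURRENCY (r) ON THE θ₀ LINE — «RELATIVE TO (5)»**: a version `𝔗`, admissible constants `c`, Thm 1's bounds (5) in the compact reading on the `L = 3` runs (LOCATED
HYPOTHESIS `h5`, print's «O(1) independent of ε, k», p. 257 L1) and per-run representation data `hdata` give N08's four-pin world at θ₀'s datum (n08-e's supplier face).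
[cite: Balaban1985UV3, Thm 1 p.257 (compact reading), Thm 2 p.272, Sect. D pp.272–275] -/
theorem exists_world₁₂C_b10_main_at_theta12OfRecord_of_thm1Compact_perRun (hP : (theta12OfRecord F N ζ Rz Zt).Provisos₁₂ F N) (Mstar : ℕ)
    (ops : OpsY N (theta12OfRecord F N ζ Rz Zt).toStage3Params Mstar) (ζ' : ResidZ F N) (lamW : ResidW F N)
    (𝔗 : TFamily₃ N 3) (c : Consts 3) (hc : c.Adm)
    (h5 : B10.Thm1PrintedCompact (runsAtG N (runObjects₀T N 𝔗 (Backgrounds.ofPrint N 3)) c))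
    (hdata : ∀ S : Family 3 c.eps0, ∃ (C : B10Assembly.Consts) (W : SectB.TowerObjects S.1 (SU N)),
      W.toRunObjects = runObjects₀T N 𝔗 (Backgrounds.ofPrint N 3) c S.1 ∧ Nonempty (B10Assembly.LeafSystem C W.pin.toTowerRun)) :
    ∃ w : WorldP, IsRecordOfRecord₁₂C F N (datumOfRecord₁₂ F N (theta12OfRecord F N ζ Rz Zt) hP) w ∧
      IsRecordOfRecord₁₂CB10YZW F N (datumOfRecord₁₂ F N (theta12OfRecord F N ζ Rz Zt) hP) w ∧ w.γ = 1 / 2 ∧ w.L = 3 ∧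
      (∀ P, w.up P = upOfRecord₅C F N ((theta12OfRecord F N ζ Rz Zt).view₁₂B10YZW F N Mstar ops ζ' lamW) P) ∧
      ∀ P : B12.RunParams, Dag.B10_main (leavesP w P) :=
  exists_world₁₂C_b10_main_at_theta12OfRecord ζ Rz Zt hP Mstar ops ζ' lamW (printedUV3V_of_thm1Compact_perRun N 3 𝔗 c hc h5 hdata)

/-- **CURRENCY (o) ON THE θ₀ LINE — PER-RUN DATA WITH A RUN-UNIFORM O(1)**: a version `𝔗`, admissible constants `c`, and per-run representation data on the `L = 3` runs
whose displayed O(1) is bounded by one `O` across the family give N08's four-pin world at θ₀'s datum (n08-a's sharpest data currency). [cite: Balaban1985UV3, Thm 1 p.257 L1, Thm 2 p.272, Sect. D pp.272–274] -/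
theorem exists_world₁₂C_b10_main_at_theta12OfRecord_of_perRunUniformO1 (hP : (theta12OfRecord F N ζ Rz Zt).Provisos₁₂ F N) (Mstar : ℕ)
    (ops : OpsY N (theta12OfRecord F N ζ Rz Zt).toStage3Params Mstar) (ζ' : ResidZ F N) (lamW : ResidW F N)
    (𝔗 : TFamily₃ N 3) (c : Consts 3) (hc : c.Adm) (O : ℝ → ℝ → ℝ)
    (h : ∀ S : Family 3 c.eps0, ∃ (C : B10Assembly.Consts) (W : SectB.TowerObjects S.1 (SU N)),
      W.toRunObjects = runObjects₀T N 𝔗 (Backgrounds.ofPrint N 3) c S.1 ∧ Nonempty (B10Assembly.LeafSystem C W.pin.toTowerRun) ∧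
        ∀ gmin gmax : ℝ, 0 < gmin → gmin ≤ gmax → B10Assembly.O1 C gmin gmax ≤ O gmin gmax) :
    ∃ w : WorldP, IsRecordOfRecord₁₂C F N (datumOfRecord₁₂ F N (theta12OfRecord F N ζ Rz Zt) hP) w ∧
      IsRecordOfRecord₁₂CB10YZW F N (datumOfRecord₁₂ F N (theta12OfRecord F N ζ Rz Zt) hP) w ∧ w.γ = 1 / 2 ∧ w.L = 3 ∧
      (∀ P, w.up P = upOfRecord₅C F N ((theta12OfRecord F N ζ Rz Zt).view₁₂B10YZW F N Mstar ops ζ' lamW) P) ∧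
      ∀ P : B12.RunParams, Dag.B10_main (leavesP w P) :=
  exists_world₁₂C_b10_main_at_theta12OfRecord ζ Rz Zt hP Mstar ops ζ' lamW (printedUV3V_of_perRunUniformO1 N 3 𝔗 c hc O h)

end WitnessLine

/-! ## §C THE RE-PINNED WITNESS LINE OF RECORD `θ₀ˡⁱᵛᵉ = theta12LiveOfRecord F N ζ Rz Zt = (theta12OfRecord F N ζ Rz Zt).liveRepin F N` (node00-def-K0a, p477230), BY NAME -/

section LiveWitnessLine
variable (ζ : ZetaOfRecord F N numerics7OfRecord₁₂ 1) (Rz : (K : ℕ) → Sect2.Residual (F.P K) (MatA N)) (Zt : (K : ℕ) → TkResidualW F N (FluctV N) K)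

/-- **`θ₀ˡⁱᵛᵉ` keeps Bałaban's block size `L = 3`** (`rfl`: the live re-pin changes the selector only). [cite: Balaban1987RG1, (0.21) p.256 (the numerics of record; bookkeeping); Balaban1989LargeFieldI, (0.3) p.176] -/
theorem theta12LiveOfRecord_L : (theta12LiveOfRecord F N ζ Rz Zt).L = 3 := rfl

/-- **`θ₀ˡⁱᵛᵉ`'s Stage-3 carrier part IS `θ₀`'s** (`rfl`) — an operator ∕ [B8] ∕ [B13] residual layer typed at `θ₀` serves `θ₀ˡⁱᵛᵉ` verbatim. [cite: Balaban1989LargeFieldII, Thm 1 + (0.1) pp.355–356 (objects of record; bookkeeping)] -/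
theorem theta12LiveOfRecord_toStage3Params :
    (theta12LiveOfRecord F N ζ Rz Zt).toStage3Params = (theta12OfRecord F N ζ Rz Zt).toStage3Params := rfl

/-- **N08's SHARE OF `stub_nodes12` ON THE RE-PINNED WITNESS LINE OF RECORD COSTS K0′'s PROVISOS THERE AND THE SINGLE PROP `PrintedUV3V N 3`**: a four-pin world of
`datumOfRecord₁₂ F N θ₀ˡⁱᵛᵉ hP` (package exposed — floor `Mstar`, operator layer `ops` typed at `θ₀`'s Stage-3 part, [B11] layer `ζ'`, [IV] layer `lamW` —, `w.γ = 1∕2`, `w.L = 3`)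
that is a `₁₂C` and a `₁₂CB10YZW` record and carries N08 at every run; admissibility is node00-def-K0a's theorem `admissible_theta12LiveOfRecord`, the window height
`theta12LiveOfRecord_γ`.  §A's `exists_world₁₂C_b10_main_of_slot_reselect` at `sel :=` the live selector of record.  At `N = 2`: [Balaban1985UV3] Thm 1-compact ∧ Thm 2 with
their printed ∃-prefix for SU(2), block size 3, at some version of print's transformations. [cite: Balaban1985UV3, Thm 1 p.257, Thm 2 p.272; Balaban1989LargeFieldII, Thm 1 + (0.1) pp.355–356; Balaban1989LargeFieldI, (0.3) p.176; Balaban1987RG1, (0.21) p.256 (bookkeeping)] -/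
theorem exists_world₁₂C_b10_main_at_theta12LiveOfRecord (hP : (theta12LiveOfRecord F N ζ Rz Zt).Provisos₁₂ F N) (Mstar : ℕ)
    (ops : OpsY N (theta12OfRecord F N ζ Rz Zt).toStage3Params Mstar) (ζ' : ResidZ F N) (lamW : ResidW F N) (hUV : PrintedUV3V N 3) :
    ∃ w : WorldP, IsRecordOfRecord₁₂C F N (datumOfRecord₁₂ F N (theta12LiveOfRecord F N ζ Rz Zt) hP) w ∧
      IsRecordOfRecord₁₂CB10YZW F N (datumOfRecord₁₂ F N (theta12LiveOfRecord F N ζ Rz Zt) hP) w ∧ w.γ = 1 / 2 ∧ w.L = 3 ∧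
      (∀ P, w.up P = upOfRecord₅C F N ((theta12LiveOfRecord F N ζ Rz Zt).view₁₂B10YZW F N Mstar ops ζ' lamW) P) ∧
      ∀ P : B12.RunParams, Dag.B10_main (leavesP w P) := by
  obtain ⟨w, hC, hR, hγ, hL, hup, hN⟩ := exists_world₁₂C_b10_main_of_slot_reselect (theta12OfRecord F N ζ Rz Zt) _ hP
    (admissible_theta12OfRecord F N ζ Rz Zt) Mstar ops ζ' lamW (γw := 1 / 2) ⟨one_half_pos, (theta12OfRecord_γ F N ζ Rz Zt).symm.le⟩
    ((theta12OfRecord_L ζ Rz Zt).symm ▸ hUV)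
  exact ⟨w, hC, hR, hγ, by rw [hL, theta12OfRecord_L]; norm_num, hup, hN⟩

/-- **EXACT COST ON THE RE-PINNED LINE**: at any world whose upstream block is the four-pin C-binding of `θ₀ˡⁱᵛᵉ`, N08 at a run ⟺ «in-edge leaves ⟹ `PrintedUV3V N 3`».
[cite: Balaban1985UV3, Thm 1 p.257, Thm 2 p.272] -/
theorem b10_main_iff_at_theta12LiveOfRecord {w : WorldP} (Mstar : ℕ) (ops : OpsY N (theta12OfRecord F N ζ Rz Zt).toStage3Params Mstar)
    (ζ' : ResidZ F N) (lamW : ResidW F N)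
    (hup : ∀ P, w.up P = upOfRecord₅C F N ((theta12LiveOfRecord F N ζ Rz Zt).view₁₂B10YZW F N Mstar ops ζ' lamW) P) (P : B12.RunParams) :
    Dag.B10_main (leavesP w P) ↔
      ((leavesP w P).b5 → (leavesP w P).b6 → (leavesP w P).b7 → (leavesP w P).b8 → (leavesP w P).b9 → (leavesP w P).b11 → PrintedUV3V N 3) :=
  b10_main_iff_of_upC_view₁₂B10YZW (theta12LiveOfRecord F N ζ Rz Zt) Mstar ops ζ' lamW hup P

/-- **The [B8]-keyed five-pin world on the re-pinned line** ([B8] layer `lam` typed at `θ₀`'s Stage-3 part), from K0′'s provisos there and `PrintedUV3V N 3`.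
[cite: Balaban1985UV3, Thm 1 p.257, Thm 2 p.272; Balaban1985RegularSpaces, Thm 8 p.101; Balaban1987RG1, (0.21) p.256 (bookkeeping)] -/
theorem exists_world₁₂CB10YZWB8_b10_main_at_theta12LiveOfRecord (hP : (theta12LiveOfRecord F N ζ Rz Zt).Provisos₁₂ F N)
    (lam : ResidB8 (theta12OfRecord F N ζ Rz Zt).toStage3Params) (Mstar : ℕ) (ops : OpsY N (theta12OfRecord F N ζ Rz Zt).toStage3Params Mstar)
    (ζ' : ResidZ F N) (lamW : ResidW F N) (hUV : PrintedUV3V N 3) :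
    ∃ w : WorldP, IsRecordOfRecord₁₂CB10YZWB8 F N (datumOfRecord₁₂ F N (theta12LiveOfRecord F N ζ Rz Zt) hP) w ∧ w.γ = 1 / 2 ∧ w.L = 3 ∧
      (∀ P, w.up P = upOfRecord₅CS F N ((theta12LiveOfRecord F N ζ Rz Zt).view₁₂B8B10YZW F N lam Mstar ops ζ' lamW) P) ∧
      ∀ P : B12.RunParams, Dag.B10_main (leavesP w P) := by
  obtain ⟨w, hR, hγ, hL, hup, hN⟩ := exists_world₁₂CB10YZWB8_b10_main_of_slot_reselect (theta12OfRecord F N ζ Rz Zt) _ hP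
    (admissible_theta12OfRecord F N ζ Rz Zt) lam Mstar ops ζ' lamW (γw := 1 / 2) ⟨one_half_pos, (theta12OfRecord_γ F N ζ Rz Zt).symm.le⟩
    ((theta12OfRecord_L ζ Rz Zt).symm ▸ hUV)
  exact ⟨w, hR, hγ, by rw [hL, theta12OfRecord_L]; norm_num, hup, hN⟩

/-- **CURRENCY (u) ON THE RE-PINNED LINE**: uniform leaf systems on print's `L = 3` runs at a version `𝔗`. [cite: Balaban1985UV3, Thm 1 p.257, Thm 2 p.272, Sect. D pp.272–275; Balaban1985Averaging, (10) p.19] -/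
theorem exists_world₁₂C_b10_main_at_theta12LiveOfRecord_of_uniformLeafSystemsG (hP : (theta12LiveOfRecord F N ζ Rz Zt).Provisos₁₂ F N) (Mstar : ℕ)
    (ops : OpsY N (theta12OfRecord F N ζ Rz Zt).toStage3Params Mstar) (ζ' : ResidZ F N) (lamW : ResidW F N)
    (𝔗 : TFamily₃ N 3) (c : Consts 3) (hc : c.Adm) (hU : UniformLeafSystemsG N (runObjects₀T N 𝔗 (Backgrounds.ofPrint N 3)) c) :
    ∃ w : WorldP, IsRecordOfRecord₁₂C F N (datumOfRecord₁₂ F N (theta12LiveOfRecord F N ζ Rz Zt) hP) w ∧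
      IsRecordOfRecord₁₂CB10YZW F N (datumOfRecord₁₂ F N (theta12LiveOfRecord F N ζ Rz Zt) hP) w ∧ w.γ = 1 / 2 ∧ w.L = 3 ∧
      (∀ P, w.up P = upOfRecord₅C F N ((theta12LiveOfRecord F N ζ Rz Zt).view₁₂B10YZW F N Mstar ops ζ' lamW) P) ∧
      ∀ P : B12.RunParams, Dag.B10_main (leavesP w P) :=
  exists_world₁₂C_b10_main_at_theta12LiveOfRecord ζ Rz Zt hP Mstar ops ζ' lamW (printedUV3V_of_uniformLeafSystems_at 𝔗 ⟨c, hc, hU⟩)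

/-- **CURRENCY (r) ON THE RE-PINNED LINE**: (5) in the compact reading on the `L = 3` runs (located hypothesis) + per-run representation data. [cite: Balaban1985UV3, Thm 1 p.257 (compact reading), Thm 2 p.272, Sect. D pp.272–275] -/
theorem exists_world₁₂C_b10_main_at_theta12LiveOfRecord_of_thm1Compact_perRun (hP : (theta12LiveOfRecord F N ζ Rz Zt).Provisos₁₂ F N) (Mstar : ℕ)
    (ops : OpsY N (theta12OfRecord F N ζ Rz Zt).toStage3Params Mstar) (ζ' : ResidZ F N) (lamW : ResidW F N)
    (𝔗 : TFamily₃ N 3) (c : Consts 3) (hc : c.Adm)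
    (h5 : B10.Thm1PrintedCompact (runsAtG N (runObjects₀T N 𝔗 (Backgrounds.ofPrint N 3)) c))
    (hdata : ∀ S : Family 3 c.eps0, ∃ (C : B10Assembly.Consts) (W : SectB.TowerObjects S.1 (SU N)),
      W.toRunObjects = runObjects₀T N 𝔗 (Backgrounds.ofPrint N 3) c S.1 ∧ Nonempty (B10Assembly.LeafSystem C W.pin.toTowerRun)) :
    ∃ w : WorldP, IsRecordOfRecord₁₂C F N (datumOfRecord₁₂ F N (theta12LiveOfRecord F N ζ Rz Zt) hP) w ∧
      IsRecordOfRecord₁₂CB10YZW F N (datumOfRecord₁₂ F N (theta12LiveOfRecord F N ζ Rz Zt) hP) w ∧ w.γ = 1 / 2 ∧ w.L = 3 ∧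
      (∀ P, w.up P = upOfRecord₅C F N ((theta12LiveOfRecord F N ζ Rz Zt).view₁₂B10YZW F N Mstar ops ζ' lamW) P) ∧
      ∀ P : B12.RunParams, Dag.B10_main (leavesP w P) :=
  exists_world₁₂C_b10_main_at_theta12LiveOfRecord ζ Rz Zt hP Mstar ops ζ' lamW (printedUV3V_of_thm1Compact_perRun N 3 𝔗 c hc h5 hdata)

/-- **CURRENCY (o) ON THE RE-PINNED LINE**: per-run representation data on the `L = 3` runs with a run-uniform O(1). [cite: Balaban1985UV3, Thm 1 p.257 L1, Thm 2 p.272, Sect. D pp.272–274] -/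
theorem exists_world₁₂C_b10_main_at_theta12LiveOfRecord_of_perRunUniformO1 (hP : (theta12LiveOfRecord F N ζ Rz Zt).Provisos₁₂ F N) (Mstar : ℕ)
    (ops : OpsY N (theta12OfRecord F N ζ Rz Zt).toStage3Params Mstar) (ζ' : ResidZ F N) (lamW : ResidW F N)
    (𝔗 : TFamily₃ N 3) (c : Consts 3) (hc : c.Adm) (O : ℝ → ℝ → ℝ)
    (h : ∀ S : Family 3 c.eps0, ∃ (C : B10Assembly.Consts) (W : SectB.TowerObjects S.1 (SU N)),
      W.toRunObjects = runObjects₀T N 𝔗 (Backgrounds.ofPrint N 3) c S.1 ∧ Nonempty (B10Assembly.LeafSystem C W.pin.toTowerRun) ∧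
        ∀ gmin gmax : ℝ, 0 < gmin → gmin ≤ gmax → B10Assembly.O1 C gmin gmax ≤ O gmin gmax) :
    ∃ w : WorldP, IsRecordOfRecord₁₂C F N (datumOfRecord₁₂ F N (theta12LiveOfRecord F N ζ Rz Zt) hP) w ∧
      IsRecordOfRecord₁₂CB10YZW F N (datumOfRecord₁₂ F N (theta12LiveOfRecord F N ζ Rz Zt) hP) w ∧ w.γ = 1 / 2 ∧ w.L = 3 ∧
      (∀ P, w.up P = upOfRecord₅C F N ((theta12LiveOfRecord F N ζ Rz Zt).view₁₂B10YZW F N Mstar ops ζ' lamW) P) ∧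
      ∀ P : B12.RunParams, Dag.B10_main (leavesP w P) :=
  exists_world₁₂C_b10_main_at_theta12LiveOfRecord ζ Rz Zt hP Mstar ops ζ' lamW (printedUV3V_of_perRunUniformO1 N 3 𝔗 c hc O h)

end LiveWitnessLine

/-! ## §D N08's CONJUNCT OF `NodesAtSomeRecord12`, WITNESSED AT `θ₀ˡⁱᵛᵉ` AT K0b's RESIDUALS OF RECORD — the guard conjuncts BY NAME (node00-def-K0a ∕ K0b), opaque -/

section LiveConjunct
variable (F N)

/-- **ON THE RE-PINNED WITNESS LINE AT THE RESIDUALS OF RECORD** (`ζ := zeta316OfRecord …`, `Rz := RzOfRecord`, `Zt := ZtOfRecord`, where node00-def-K0a proves print's partition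
of unity `ztUnity_theta12LiveOfRecord` and admissibility `admissible_theta12LiveOfRecord`): GIVEN K0′'s provisos `hP` and its slot-nondegeneracy conjunct `hS` there (K0′'s
two open rows, HYPOTHESES, opaque — `hS` is read BY NAME, so this statement is indifferent to def-T's `Record12` v2.3 guard) and the slot `PrintedUV3V N 3`, N08's conjunct
of plan g64's `NodesAtSomeRecord12` — «SOME guarded admissible tuple, provisos and `₁₂C`-record world carrying `Dag.B10_main` at every run» — is witnessed AT `θ₀ˡⁱᵛᵉ`
itself with a four-pin world (floor `0`, N06's junk operator layer, degenerate [B11] ∕ [IV] layers, `w.γ = 1∕2`).  NOT the stub (twelve conjuncts missing), NOT a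
discharge. [cite: Balaban1985UV3, Thm 1 p.257, Thm 2 p.272; Balaban1988Convergent, Thm 1 p.262, (3.16)–(3.22) pp.268–269; Balaban1989LargeFieldII, Thm 1 + (0.1) pp.355–356 (bookkeeping)] -/
theorem exists_guarded_record₁₂C_b10_main_at_theta12LiveOfRecord
    (hP : (theta12LiveOfRecord F N (zeta316OfRecord F N numerics7OfRecord₁₂ 1 1) (RzOfRecord F N) (ZtOfRecord F N)).Provisos₁₂ F N)
    (hS : (theta12LiveOfRecord F N (zeta316OfRecord F N numerics7OfRecord₁₂ 1 1) (RzOfRecord F N) (ZtOfRecord F N)).SlotsNondegenerate)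
    (hUV : PrintedUV3V N 3) :
    ∃ w : WorldP,
      ((theta12LiveOfRecord F N (zeta316OfRecord F N numerics7OfRecord₁₂ 1 1) (RzOfRecord F N) (ZtOfRecord F N)).ZtUnity F N ∧
        (theta12LiveOfRecord F N (zeta316OfRecord F N numerics7OfRecord₁₂ 1 1) (RzOfRecord F N) (ZtOfRecord F N)).SlotsNondegenerate) ∧
      (theta12LiveOfRecord F N (zeta316OfRecord F N numerics7OfRecord₁₂ 1 1) (RzOfRecord F N) (ZtOfRecord F N)).Admissible F N ∧
      IsRecordOfRecord₁₂C F N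
        (datumOfRecord₁₂ F N (theta12LiveOfRecord F N (zeta316OfRecord F N numerics7OfRecord₁₂ 1 1) (RzOfRecord F N) (ZtOfRecord F N)) hP) w ∧
      w.γ = 1 / 2 ∧ w.L = 3 ∧ ∀ P : B12.RunParams, Dag.B10_main (leavesP w P) := by
  obtain ⟨ops, -, -⟩ := exists_junkOps_b9LeafX_Y9OfRecord (N := N)
    (theta12OfRecord F N (zeta316OfRecord F N numerics7OfRecord₁₂ 1 1) (RzOfRecord F N) (ZtOfRecord F N)).toStage3Params
    (admissible_theta12OfRecord F N _ _ _).1.1.1.1.1 0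
  obtain ⟨ζ'⟩ := nonempty_residZ F N
  obtain ⟨lamW⟩ := nonempty_residW F N
  obtain ⟨w, hC, -, hγ, hL, -, hN⟩ := exists_world₁₂C_b10_main_at_theta12LiveOfRecord _ _ _ hP 0 ops ζ' lamW hUV
  exact ⟨w, ⟨ztUnity_theta12LiveOfRecord F N, hS⟩, admissible_theta12LiveOfRecord F N _ _ _, hC, hγ, hL, hN⟩

/-- **THE SAME AT THE GROUP OF RECORD `N = 2`, CONCLUSION = N08's CONJUNCT OF `NodesAtSomeRecord12 F` IN ITS OWN ∃-BINDER TEXT** (plan g64 `K1Skeleton12`, rev 15): from K0′'s two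
open rows at `θ₀ˡⁱᵛᵉ` and `PrintedUV3V 2 3` ([Balaban1985UV3] Thm 1-compact ∧ Thm 2 for SU(2), block size 3, some version of print's transformations).  N08's line for the K1′
assembler on the witness of record; NOT the stub, NOT a discharge. [cite: Balaban1985UV3, Thm 1 p.257, Thm 2 p.272; Balaban1988Convergent, Thm 1 p.262, (3.16)–(3.22) pp.268–269; Balaban1989LargeFieldII, Thm 1 + (0.1) pp.355–356 (bookkeeping)] -/
theorem exists_guarded_record₁₂C_b10_main_of_theta12Live_two (F : T4Family)
    (hP : (theta12LiveOfRecord F 2 (zeta316OfRecord F 2 numerics7OfRecord₁₂ 1 1) (RzOfRecord F 2) (ZtOfRecord F 2)).Provisos₁₂ F 2)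
    (hS : (theta12LiveOfRecord F 2 (zeta316OfRecord F 2 numerics7OfRecord₁₂ 1 1) (RzOfRecord F 2) (ZtOfRecord F 2)).SlotsNondegenerate)
    (hUV : PrintedUV3V 2 3) :
    ∃ (θ : Stage12Params F 2) (h : θ.Provisos₁₂ F 2) (w : WorldP), (θ.ZtUnity F 2 ∧ θ.SlotsNondegenerate) ∧ θ.Admissible F 2 ∧
      IsRecordOfRecord₁₂C F 2 (datumOfRecord₁₂ F 2 θ h) w ∧ ∀ P : B12.RunParams, Dag.B10_main (leavesP w P) := by
  obtain ⟨w, hG, hθ, hC, -, -, hN⟩ := exists_guarded_record₁₂C_b10_main_at_theta12LiveOfRecord F 2 hP hS hUV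
  exact ⟨_, hP, w, hG, hθ, hC, hN⟩

end LiveConjunct

/-! ## §D′ (v1.1) THE SAME FROM K0′'s PROVISOS ALONE — `hS` discharged by node00-def-K0a's `slotsNondegenerate_theta12LiveOfRecord` (`Record12LiveSelectorTorus` v1.1, def-T `Record12` v2.3) -/

section LiveConjunctProvisos
variable (F N)

/-- **★ ON THE RE-PINNED WITNESS LINE OF RECORD, N08's CONJUNCT OF `NodesAtSomeRecord12` COSTS K0′'s PROVISOS THERE AND `PrintedUV3V N 3` — NOTHING ELSE**: the
slot-nondegeneracy conjunct is node00-def-K0a's THEOREM `slotsNondegenerate_theta12LiveOfRecord` from the `base` field (`Provisos₁₀`) of the provisos (def-T `Record12` v2.3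
guard `k ≤ p.K`, director-ym LINE №118; K0a `Record12LiveSelectorTorus` v1.1), print's partition of unity and admissibility are K0a's theorems at K0b's residuals of record.
HYPOTHESES: `hP` (K0′'s open rows at the line — never constructed here) and the slot `PrintedUV3V N 3` (N08's object gap).  NOT the stub, NOT a discharge.
[cite: Balaban1985UV3, Thm 1 p.257, Thm 2 p.272; Balaban1988Convergent, Thm 1 p.262, (3.16)–(3.22) pp.268–269, (3.24) p.270; Balaban1989LargeFieldI, (0.3)–(0.4) p.176; Balaban1989LargeFieldII, Thm 1 + (0.1) pp.355–356 (bookkeeping)] -/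
theorem exists_guarded_record₁₂C_b10_main_at_theta12LiveOfRecord_of_provisos
    (hP : (theta12LiveOfRecord F N (zeta316OfRecord F N numerics7OfRecord₁₂ 1 1) (RzOfRecord F N) (ZtOfRecord F N)).Provisos₁₂ F N)
    (hUV : PrintedUV3V N 3) :
    ∃ w : WorldP,
      ((theta12LiveOfRecord F N (zeta316OfRecord F N numerics7OfRecord₁₂ 1 1) (RzOfRecord F N) (ZtOfRecord F N)).ZtUnity F N ∧
        (theta12LiveOfRecord F N (zeta316OfRecord F N numerics7OfRecord₁₂ 1 1) (RzOfRecord F N) (ZtOfRecord F N)).SlotsNondegenerate) ∧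
      (theta12LiveOfRecord F N (zeta316OfRecord F N numerics7OfRecord₁₂ 1 1) (RzOfRecord F N) (ZtOfRecord F N)).Admissible F N ∧
      IsRecordOfRecord₁₂C F N
        (datumOfRecord₁₂ F N (theta12LiveOfRecord F N (zeta316OfRecord F N numerics7OfRecord₁₂ 1 1) (RzOfRecord F N) (ZtOfRecord F N)) hP) w ∧
      w.γ = 1 / 2 ∧ w.L = 3 ∧ ∀ P : B12.RunParams, Dag.B10_main (leavesP w P) :=
  exists_guarded_record₁₂C_b10_main_at_theta12LiveOfRecord F N hP (slotsNondegenerate_theta12LiveOfRecord F N _ _ _ hP.base) hUV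

/-- **★ `N = 2`, CONCLUSION = N08's CONJUNCT OF `NodesAtSomeRecord12 F` IN ITS OWN ∃-BINDER TEXT, HYPOTHESES = K0′'s PROVISOS AT `θ₀ˡⁱᵛᵉ` + `PrintedUV3V 2 3`** ([Balaban1985UV3]
Thm 1-compact ∧ Thm 2 for SU(2), block size 3, at some version of print's transformations): N08's line for the K1′ assembler on the witness of record — it pairs with K0a's
`exists_k0prime_of_theta12Live_of_provisos₁₂`, the K0′ body for `F` from the same `hP`.  NOT the stub, NOT a discharge. [cite: Balaban1985UV3, Thm 1 p.257, Thm 2 p.272; Balaban1988Convergent, Thm 1 p.262, (3.16)–(3.22) pp.268–269; Balaban1989LargeFieldII, Thm 1 + (0.1) pp.355–356 (bookkeeping)] -/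
theorem exists_guarded_record₁₂C_b10_main_of_theta12Live_provisos_two (F : T4Family)
    (hP : (theta12LiveOfRecord F 2 (zeta316OfRecord F 2 numerics7OfRecord₁₂ 1 1) (RzOfRecord F 2) (ZtOfRecord F 2)).Provisos₁₂ F 2)
    (hUV : PrintedUV3V 2 3) :
    ∃ (θ : Stage12Params F 2) (h : θ.Provisos₁₂ F 2) (w : WorldP), (θ.ZtUnity F 2 ∧ θ.SlotsNondegenerate) ∧ θ.Admissible F 2 ∧
      IsRecordOfRecord₁₂C F 2 (datumOfRecord₁₂ F 2 θ h) w ∧ ∀ P : B12.RunParams, Dag.B10_main (leavesP w P) :=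
  exists_guarded_record₁₂C_b10_main_of_theta12Live_two F hP (slotsNondegenerate_theta12LiveOfRecord F 2 _ _ _ hP.base) hUV

end LiveConjunctProvisos

end Summit.QuantumFields.YangMills.BalabanUVNodes.N08StubNodes12WitnessLines

end
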